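import Summits.BirchSwinnertonDyer.BirchSwinnertonDyer.Theorems.KolyvaginDepthDoorDepthTableRowKit
import HarnessLib

/-!
# Route `KolyvaginDepthDoor` — a depth-table row DECIDES THE CRUX AT ITS CURVE: the literal
# `KolyvaginDepthSupply` clause at `W` from the bit `c_1(ℓ) ≠ 0` (crux stmt-BirchSwinnertonDyer-21765)

Helper file (`--supports stmt-BirchSwinnertonDyer-21765 --as helper`); it closes nothing and BSD is
not proved by it. CONDITIONAL on Kolyvagin 1991 Thm. 4 (`hF`, the route's support item
`KolyvaginStructure`) and on the computed bit.

The crux `KolyvaginDepthSupply` is `∀ W` (globally minimal, non-CM) of the CLAUSE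
"`∃ p ≥ 5` good ordinary with `ρ̄_{E,p}` onto, `∃ K` imaginary quadratic (`d_K ∉ {−3,−4}`, `p ∤ d_K N_E`,
Heegner hypothesis), `∃ (Dt, β, ι, n, d, M)` with `c_M(n) ≠ 0` of MINIMAL depth among all non-zero
classes of the system, and (`ν(n)+1 = rank E(ℚ) > rank E^{(d_K)}(ℚ)` or
`ν(n) = rank E(ℚ) = rank E^{(d_K)}(ℚ) − 1`)". The row kit (`KolyvaginDepthDoorDepthTableRowKit`)
turns concrete admissible data + a kernel rank certificate `2 ≤ rank` + the bit `c_1(ℓ) ≠ 0` into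
`t_p = 0 ∧ rank = 2 ∧ s_p(E) = 2 ∧ s_p(E^{(d_K)}) = 1`. THIS file closes the remaining gap to the
crux's own wording AT THAT CURVE:

* `kolyvaginDepthSupply_clause_of_intModel_certificate` — under the hypotheses of
  `depthRow_of_intModel_certificate` plus the ordinary certificate at `p` (`p ∤ a_p`), the crux's
  clause holds VERBATIM for `W` (with the row's `p` and `K`): the witness `(n₀, d₀, M₀)` is the
  minimal non-zero class of the system (`exists_minimal_kolyvaginClass_ne_zero`, g0's bookkeeping);
  Kolyvagin's dichotomy at it, against `s_p(E) = 2` from the row, forces `ν(n₀) = 1`, and the rank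
  clause `ν(n₀) + 1 = 2 = rank E(ℚ) > rank E^{(d_K)}(ℚ)` follows from `rank = 2` (row) and Kummer on
  the twist (`rank E^{(d_K)} ≤ s_p(E^{(d_K)}) ≤ 1`, tree `selmerCorank_eq_mordellWeilRank_add_holds`).

So for each of the 18 depth-table curves the route's crux, RESTRICTED TO THAT CURVE, is decided by
ONE computation modulo `hF` (per-curve corollaries `C<label>.kolyvaginDepthSupply_clause` in the
sequel files). Class-wide the crux stays what g0's calibration says (X1 on non-CM curves at a
surjective prime, p582259); nothing here moves it.

References: [Kolyvagin1991MathAnn] §2 Thm. 4; [WZhang2014] Thm. 11.2 (i), Notations (xii);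
[GreenbergLNM1716] §1 pp. 54–57 (Kummer); [JetchevLauterStein2009] arXiv:0707.0032 §3.6.
-/

set_option linter.dupNamespace false

noncomputable section

open scoped Classical NumberField

namespace Summit.BirchSwinnertonDyer.BirchSwinnertonDyer.Theorems.KolyvaginDepthDoor

open Literature.NumberTheory.EllipticCurves Literature.NumberTheory.EllipticCurves.ModularForms
  WeierstrassCurve
open Summit.BirchSwinnertonDyer.BirchSwinnertonDyer.Rank1Residual

/-- **Sanity: the clause below IS the crux's.** `KolyvaginDepthSupply` unfolds, by `Iff.rfl`, to
"every non-CM globally minimal elliptic `W` satisfies the clause" — so the per-curve theorems of the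
sequel files prove literally the crux's body at their curve. [folklore] -/
theorem kolyvaginDepthSupply_iff_forall_clause :
    Summit.BirchSwinnertonDyer.BirchSwinnertonDyer.Theses.KolyvaginDepthDoor.KolyvaginDepthSupply ↔
    ∀ (W : WeierstrassCurve ℚ) [W.IsElliptic] [W.IsGloballyMinimal], ¬ W.HasCM →
      ∃ (p : ℕ) (hp : Fact p.Prime), 5 ≤ p ∧ W.HasGoodReductionAtPrime p ∧ ¬ (p : ℤ) ∣
      W.frobeniusTrace p ∧ W.HasSurjectiveModNGaloisRep p ∧ ∃ (K : Type) (_ : Field K) (_ :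
      NumberField K), Literature.NumberTheory.EllipticCurves.IsImaginaryQuadratic K ∧
      NumberField.discr K ≠ -3 ∧ NumberField.discr K ≠ -4 ∧ ¬ ((p : ℤ) ∣ NumberField.discr K) ∧ ¬ (p
      ∣ W.conductorNorm ℤ) ∧ ∃ (_ : NeZero (W.conductorNorm ℤ)),
      Literature.NumberTheory.EllipticCurves.SatisfiesHeegnerHypothesis (W.conductorNorm ℤ) K ∧ ∃
      (Dt : Literature.NumberTheory.EllipticCurves.ModularForms.ModularParametrizationData W
      (W.conductorNorm ℤ)) (β : ℤ) (ι : K →+* ℂ) (n : ℕ) (d :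
      Literature.NumberTheory.EllipticCurves.KolyvaginHeegnerData Dt β ι n) (M : ℕ),
      Literature.NumberTheory.EllipticCurves.KolyvaginDescent.KolSupp
      (Literature.NumberTheory.EllipticCurves.Zhang2014.IsKolyvaginPrime (W.conductorNorm ℤ) W K p)
      n ∧ 1 ≤ M ∧ (M : ℕ∞) ≤ Literature.NumberTheory.EllipticCurves.Zhang2014.levelIndex W p n ∧
      d.kolyvaginClass hp.out M ≠ 0 ∧ (∀ (n' : ℕ) (d' :
      Literature.NumberTheory.EllipticCurves.KolyvaginHeegnerData Dt β ι n') (M' : ℕ),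
      Literature.NumberTheory.EllipticCurves.KolyvaginDescent.KolSupp
      (Literature.NumberTheory.EllipticCurves.Zhang2014.IsKolyvaginPrime (W.conductorNorm ℤ) W K p)
      n' → 1 ≤ M' → (M' : ℕ∞) ≤ Literature.NumberTheory.EllipticCurves.Zhang2014.levelIndex W p n' →
      d'.kolyvaginClass hp.out M' ≠ 0 → n.primeFactors.card ≤ n'.primeFactors.card) ∧
      ((n.primeFactors.card + 1 = W.mordellWeilRank ∧ (W.quadraticTwist (NumberField.discr K :
      ℚ)).mordellWeilRank < W.mordellWeilRank) ∨ (n.primeFactors.card = W.mordellWeilRank ∧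
      (W.quadraticTwist (NumberField.discr K : ℚ)).mordellWeilRank = W.mordellWeilRank + 1)) :=
  Iff.rfl

section Generic

variable {W : WeierstrassCurve ℚ} [W.IsElliptic] [W.IsGloballyMinimal] {E₀ : WeierstrassCurve ℤ}
  (hI : integralModelInt W = E₀)
include hI

/-- **The crux clause at `W` from a depth-table row (modulo Kolyvagin 1991 Thm. 4).** Inputs as in
`depthRow_of_intModel_certificate` (integral model `E₀`, `2 ≤ rank_ℤ E(ℚ)`, `p ≥ 5` with
`p ∤ Δ(E₀)` and `ρ̄_{E,p}` onto, `K` of discriminant `D ∉ {−3,−4}`, `p ∤ D`, every prime of `Δ(E₀)`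
split in `K`, an odd Kolyvagin prime `ℓ` read off the point count, data `(Dt, β, ι, d)` of conductor
`ℓ`, the bit `c_1(ℓ) ≠ 0`) PLUS the ordinary certificate `p ∤ a_p = p + 1 − #(E₀ mod p)(𝔽_p)`.
Output: the clause of `KolyvaginDepthSupply` at `W`, verbatim, witnessed by `p`, `K` and the minimal
non-zero class of the system (depth `1`, rank clause `1 + 1 = rank E(ℚ) > rank E^{(d_K)}(ℚ)`).
CONDITIONAL on `hF` and the bit; per-curve; BSD is not proved by it.
[cite: Kolyvagin1991MathAnn, §2 Thm. 4] [cite: WZhang2014, Thm. 11.2 (i) (p. 248)]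
[cite: GreenbergLNM1716, §1 pp. 54–57] -/
theorem kolyvaginDepthSupply_clause_of_intModel_certificate
    (hF : Kolyvagin1991_selmerCorank_of_kolyvaginClass_ne_zero) (hr : 2 ≤ W.mordellWeilRank)
    (p : ℕ) [hp : Fact p.Prime] (h5 : 5 ≤ p) (hpΔ : ¬ (p : ℤ) ∣ E₀.Δ) {np : ℕ}
    (hcardp : Nat.card ((E₀.map (Int.castRingHom (ZMod p))).toAffine.Point) = np)
    (hord : ¬ (p : ℤ) ∣ (p : ℤ) + 1 - np) (hsurj : W.HasSurjectiveModNGaloisRep p)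
    (K : Type) [Field K] [NumberField K] (hK : IsImaginaryQuadratic K) {D : ℤ}
    (hD : NumberField.discr K = D) (h3 : D ≠ -3) (h4 : D ≠ -4) (hpD : ¬ (p : ℤ) ∣ D)
    (hH : ∀ q : ℕ, q.Prime → (q : ℤ) ∣ E₀.Δ → (q = 2 → D % 8 = 1) ∧ (q ≠ 2 → jacobiSym D q = 1))
    (ℓ : ℕ) (hℓ : ℓ.Prime) (hℓ2 : ℓ ≠ 2) (hℓΔ : ¬ (ℓ : ℤ) ∣ E₀.Δ) (hℓD : ¬ (ℓ : ℤ) ∣ D)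
    (hℓp : ℓ ≠ p) (hjac : jacobiSym D ℓ = -1) (hℓ1 : p ∣ ℓ + 1) {n : ℕ}
    (hcard : Nat.card ((E₀.map (Int.castRingHom (ZMod ℓ))).toAffine.Point) = n)
    (haℓ : (p : ℤ) ∣ (ℓ : ℤ) + 1 - n)
    [NeZero (W.conductorNorm ℤ)] (Dt : ModularParametrizationData W (W.conductorNorm ℤ)) (β : ℤ)
    (ι : K →+* ℂ) (d : KolyvaginHeegnerData Dt β ι ℓ) (hne : d.kolyvaginClass hp.out 1 ≠ 0) :
    ∃ (p : ℕ) (hp : Fact p.Prime), 5 ≤ p ∧ W.HasGoodReductionAtPrime p ∧ ¬ (p : ℤ) ∣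
      W.frobeniusTrace p ∧ W.HasSurjectiveModNGaloisRep p ∧ ∃ (K : Type) (_ : Field K) (_ :
      NumberField K), Literature.NumberTheory.EllipticCurves.IsImaginaryQuadratic K ∧
      NumberField.discr K ≠ -3 ∧ NumberField.discr K ≠ -4 ∧ ¬ ((p : ℤ) ∣ NumberField.discr K) ∧ ¬ (p
      ∣ W.conductorNorm ℤ) ∧ ∃ (_ : NeZero (W.conductorNorm ℤ)),
      Literature.NumberTheory.EllipticCurves.SatisfiesHeegnerHypothesis (W.conductorNorm ℤ) K ∧ ∃
      (Dt : Literature.NumberTheory.EllipticCurves.ModularForms.ModularParametrizationData W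
      (W.conductorNorm ℤ)) (β : ℤ) (ι : K →+* ℂ) (n : ℕ) (d :
      Literature.NumberTheory.EllipticCurves.KolyvaginHeegnerData Dt β ι n) (M : ℕ),
      Literature.NumberTheory.EllipticCurves.KolyvaginDescent.KolSupp
      (Literature.NumberTheory.EllipticCurves.Zhang2014.IsKolyvaginPrime (W.conductorNorm ℤ) W K p)
      n ∧ 1 ≤ M ∧ (M : ℕ∞) ≤ Literature.NumberTheory.EllipticCurves.Zhang2014.levelIndex W p n ∧
      d.kolyvaginClass hp.out M ≠ 0 ∧ (∀ (n' : ℕ) (d' :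
      Literature.NumberTheory.EllipticCurves.KolyvaginHeegnerData Dt β ι n') (M' : ℕ),
      Literature.NumberTheory.EllipticCurves.KolyvaginDescent.KolSupp
      (Literature.NumberTheory.EllipticCurves.Zhang2014.IsKolyvaginPrime (W.conductorNorm ℤ) W K p)
      n' → 1 ≤ M' → (M' : ℕ∞) ≤ Literature.NumberTheory.EllipticCurves.Zhang2014.levelIndex W p n' →
      d'.kolyvaginClass hp.out M' ≠ 0 → n.primeFactors.card ≤ n'.primeFactors.card) ∧
      ((n.primeFactors.card + 1 = W.mordellWeilRank ∧ (W.quadraticTwist (NumberField.discr K :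
      ℚ)).mordellWeilRank < W.mordellWeilRank) ∨ (n.primeFactors.card = W.mordellWeilRank ∧
      (W.quadraticTwist (NumberField.discr K : ℚ)).mordellWeilRank = W.mordellWeilRank + 1)) := by
  obtain ⟨hgood, hordW⟩ := goodOrdinary_of_intModel_certificate hI p hpΔ hcardp hord
  have hpN : ¬ p ∣ W.conductorNorm ℤ := not_dvd_conductorNorm_of_not_dvd_Δ hI hp.out hpΔ
  have hHN : SatisfiesHeegnerHypothesis (W.conductorNorm ℤ) K :=
    satisfiesHeegnerHypothesis_conductorNorm_of_intModel hI K hK.1 hD hH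
  have h3' : NumberField.discr K ≠ -3 := by rw [hD]; exact h3
  have h4' : NumberField.discr K ≠ -4 := by rw [hD]; exact h4
  have hpd' : ¬ ((p : ℤ) ∣ NumberField.discr K) := by rw [hD]; exact hpD
  obtain ⟨hkol, hlev⟩ := isKolyvaginPrime_of_intModel_certificate hI p K hK.1 hD ℓ hℓ hℓ2 hℓΔ hℓD
    hℓp hjac hℓ1 hcard haℓ
  have hΛ : KolyvaginDescent.KolSupp (Zhang2014.IsKolyvaginPrime (W.conductorNorm ℤ) W K p) ℓ :=
    KolyvaginDescent.kolSupp_prime hℓ hkol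
  -- the row: `t_p = 0`, `rank = 2`, `s_p(E) = 2`, `s_p(E^{(D)}) = 1`
  obtain ⟨-, hrank, hc, hc'⟩ := depthRow_of_intModel_certificate hI hF hr p h5 hpΔ hsurj K hK hD h3
    h4 hpD hH ℓ hℓ hℓ2 hℓΔ hℓD hℓp hjac hℓ1 hcard haℓ Dt β ι d hne
  rw [← hD] at hc'
  -- the minimal non-zero class of the system and Kolyvagin's dichotomy at it
  obtain ⟨n₀, d₀, M₀, hΛ₀, hM₀, hM₀le, hne₀, hle, hmin, hdich⟩ :=
    exists_minimal_kolyvaginClass_ne_zero hF W p h5 hsurj K hK h3' h4' hpd' hpN hHN Dt β ι ℓ d 1 hΛ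
      le_rfl hlev hne
  have hνℓ : ℓ.primeFactors.card = 1 := by rw [hℓ.primeFactors, Finset.card_singleton]
  rw [hνℓ] at hle
  -- Kummer on the twist: `rank E^{(d_K)} ≤ s_p(E^{(d_K)})`
  have hdK : (NumberField.discr K : ℚ) ≠ 0 := by exact_mod_cast NumberField.discr_ne_zero K
  haveI := W.isElliptic_quadraticTwist hdK
  have hKum := (W.quadraticTwist (NumberField.discr K : ℚ)).selmerCorank_eq_mordellWeilRank_add_holds p
  refine ⟨p, hp, h5, hgood, hordW, hsurj, K, inferInstance, inferInstance, hK, h3', h4', hpd', hpN,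
    ‹NeZero (W.conductorNorm ℤ)›, hHN, Dt, β, ι, n₀, d₀, M₀, hΛ₀, hM₀, hM₀le, hne₀, hmin, Or.inl ⟨?_, ?_⟩⟩
  · rcases hdich with ⟨h1, -, -⟩ | ⟨-, h2, -⟩ <;> omega
  · omega

end Generic

end Summit.BirchSwinnertonDyer.BirchSwinnertonDyer.Theorems.KolyvaginDepthDoor

end
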